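import Mathlib
import Summits.ValiantsHypothesis.ValiantsHypothesis.Theorems.BarrierLeverPartitionMinorsHitByVPAdditiveDoor

/-!
# Route BarrierLever — item `PartitionMinorsHitByVP` (stmt-ValiantsHypothesis-19717):
# the SUM door DOMINATES the additive door and its mirror

Helper file (`--supports stmt-ValiantsHypothesis-19717`; cell valiant-natproofs, rung V4, 𝒟-side,
prover seat val-np-p6 gen 4). Definition-free. Closes NO item.

`A(ω₀,ω)[i,j] = ∏_{c ∈ w j} (ω₀ c + Σ_{a ∈ u i} ω a c)` (additive matrix), `B(ω₀',ω')[i,j] =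
∏_{a ∈ u i} (ω₀' a + Σ_{c ∈ w j} ω' c a)` (mirror). The hypothesis of the SUM door
(`…AdditiveSum.partitionMinorsHitByVP_of_additiveSum`, p527367) asks for tables with `det (A + B) ≠ 0`.
This file proves that it is implied, layout by layout, by the hypothesis of EITHER leaf of the dead
door v5: every layout class landed through the additive door (faces / binary-contiguous columns × all
rows, OR-projections, affine and ranked tests, automorphic images, …) or through its mirror is a class on
which the SUM hypothesis is a THEOREM.

* `det_additive_rescale` — rescaling the affine function of coordinate `c` by `λ c` multiplies `det A` by
  `∏_j ∏_{c ∈ w j} λ c` (column scaling).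
* `exists_table_const_ne_zero` — GENERICITY: if some table has `det A ≠ 0`, some table with ALL constants
  `ω₀ c ≠ 0` has `det A ≠ 0` (one coordinate at a time: `det A(ω₀ + t·δ_c, ω)` is a nonzero polynomial in
  `t`, so it avoids its finitely many roots and the value `t = −ω₀ c`).
* **`additiveSum_of_additive`** — `(∃ table, det A ≠ 0) → ∃ tables, det (A + B) ≠ 0`: normalise the good
  table to `ω₀ ≡ 1`, take the zero table for `B`; then `B = [u i = ∅]` is supported on the row `u = ∅`,
  where `A ≡ 1`, so `A + B` is `A` with that row doubled.
* **`additiveSum_of_mirror`** — the same from a good MIRROR table (`det A(w,u) ≠ 0`): columns instead of rows.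
* **`additiveSum_hyp_of_dichotomy_pointwise`** — hence on every layout where the v5 disjunction holds, the v6
  hypothesis holds.

WHAT THIS IS NOT: no new layout class; nothing on crux 14610 or VP vs VNP.
-/

set_option linter.dupNamespace false

namespace Summit.ValiantsHypothesis.ValiantsHypothesis.Theorems.BarrierLever.AdditiveDoor

open Finset Polynomial

noncomputable section

variable {h : ℕ}

/-! ## 1. Rescaling and genericity of the constants -/

/-- Rescaling coordinate `c`'s affine function by `lam c` scales column `j` of the additive matrix by
`∏_{c ∈ w j} lam c`. -/
theorem det_additive_rescale {ι : Type*} [Fintype ι] [DecidableEq ι] (u w : ι → Finset (Fin h))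
    (ω₀ : Fin h → ℂ) (ω : Fin h → Fin h → ℂ) (lam : Fin h → ℂ) :
    (Matrix.of fun i j : ι => ∏ c ∈ w j, (lam c * ω₀ c + ∑ a ∈ u i, lam c * ω a c)).det =
      (∏ j, ∏ c ∈ w j, lam c) *
        (Matrix.of fun i j : ι => ∏ c ∈ w j, (ω₀ c + ∑ a ∈ u i, ω a c)).det := by
  rw [← Matrix.det_mul_row]
  congr 1
  ext i j
  simp only [Matrix.of_apply]
  rw [← Finset.prod_mul_distrib]
  refine Finset.prod_congr rfl fun c _ => ?_
  rw [mul_add, Finset.mul_sum]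

/-- **Genericity of the constants.** If some additive table is nonsingular on `(u, w)`, then some table
with all `ω₀ c ≠ 0` is. -/
theorem exists_table_const_ne_zero {ι : Type*} [Fintype ι] [DecidableEq ι] (u w : ι → Finset (Fin h))
    (hex : ∃ (ω₀ : Fin h → ℂ) (ω : Fin h → Fin h → ℂ),
      (Matrix.of fun i j : ι => ∏ c ∈ w j, (ω₀ c + ∑ a ∈ u i, ω a c)).det ≠ 0) :
    ∃ (ω₀ : Fin h → ℂ) (ω : Fin h → Fin h → ℂ), (∀ c, ω₀ c ≠ 0) ∧
      (Matrix.of fun i j : ι => ∏ c ∈ w j, (ω₀ c + ∑ a ∈ u i, ω a c)).det ≠ 0 := by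
  classical
  -- induction over a set `T` of coordinates already made nonzero
  suffices key : ∀ T : Finset (Fin h), ∃ (ω₀ : Fin h → ℂ) (ω : Fin h → Fin h → ℂ),
      (∀ c ∈ T, ω₀ c ≠ 0) ∧
      (Matrix.of fun i j : ι => ∏ c ∈ w j, (ω₀ c + ∑ a ∈ u i, ω a c)).det ≠ 0 by
    obtain ⟨ω₀, ω, hT, hdet⟩ := key Finset.univ
    exact ⟨ω₀, ω, fun c => hT c (Finset.mem_univ c), hdet⟩
  intro T
  induction T using Finset.induction_on with
  | empty =>
    obtain ⟨ω₀, ω, hdet⟩ := hex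
    exact ⟨ω₀, ω, fun c hc => absurd hc (Finset.notMem_empty c), hdet⟩
  | insert c₀ T hc₀ ih =>
    obtain ⟨ω₀, ω, hT, hdet⟩ := ih
    -- perturb the constant of coordinate `c₀` by `t`
    set Mt : ℂ → Matrix ι ι ℂ := fun t => Matrix.of fun i j : ι =>
      ∏ c ∈ w j, ((ω₀ c + if c = c₀ then t else 0) + ∑ a ∈ u i, ω a c) with hMt
    -- the determinant is a polynomial in `t`
    set MP : Matrix ι ι ℂ[X] := Matrix.of fun i j : ι =>
      ∏ c ∈ w j, ((C (ω₀ c) + if c = c₀ then X else 0) + ∑ a ∈ u i, C (ω a c)) with hMP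
    have heval : ∀ t : ℂ, (MP.det).eval t = (Mt t).det := by
      intro t
      have h1 : (Polynomial.evalRingHom t) MP.det = ((Polynomial.evalRingHom t).mapMatrix MP).det :=
        RingHom.map_det _ _
      rw [Polynomial.coe_evalRingHom] at h1
      rw [h1]
      congr 1
      ext i j
      simp only [RingHom.mapMatrix_apply, Matrix.map_apply, hMP, hMt, Matrix.of_apply,
        Polynomial.coe_evalRingHom, Polynomial.eval_prod, Polynomial.eval_add, Polynomial.eval_C,
        Polynomial.eval_finsetSum]
      refine Finset.prod_congr rfl fun c _ => ?_
      split_ifs <;> simp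
    have h0 : (Mt 0).det ≠ 0 := by
      have : Mt 0 = Matrix.of fun i j : ι => ∏ c ∈ w j, (ω₀ c + ∑ a ∈ u i, ω a c) := by
        ext i j; simp [hMt]
      rw [this]; exact hdet
    have hP : MP.det ≠ 0 := by
      intro hzero
      apply h0
      rw [← heval 0, hzero, Polynomial.eval_zero]
    -- avoid the roots and the value `-ω₀ c₀`
    obtain ⟨t, ht⟩ := Infinite.exists_notMem_finset
      (insert (-ω₀ c₀) (Polynomial.finite_setOf_isRoot hP).toFinset)
    rw [Finset.mem_insert, not_or, Set.Finite.mem_toFinset, Set.mem_setOf_eq, Polynomial.IsRoot,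
      heval t] at ht
    refine ⟨fun c => ω₀ c + if c = c₀ then t else 0, ω, ?_, ?_⟩
    · intro c hc
      rcases Finset.mem_insert.mp hc with rfl | hcT
      · simp only [if_true]
        intro hzero
        exact ht.1 (by linear_combination hzero)
      · have hne : c ≠ c₀ := fun heq => hc₀ (heq ▸ hcT)
        simp only [if_neg hne, add_zero]
        exact hT c hcT
    · exact ht.2

/-! ## 2. Domination -/

/-- **The SUM door dominates the additive door.** If some additive table is nonsingular on `(u, w)`,
some pair of tables makes the SUM matrix `A + B` nonsingular. -/
theorem additiveSum_of_additive {ι : Type*} [Fintype ι] [DecidableEq ι] (u w : ι → Finset (Fin h))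
    (hex : ∃ (ω₀ : Fin h → ℂ) (ω : Fin h → Fin h → ℂ),
      (Matrix.of fun i j : ι => ∏ c ∈ w j, (ω₀ c + ∑ a ∈ u i, ω a c)).det ≠ 0) :
    ∃ (ω₀ : Fin h → ℂ) (ω : Fin h → Fin h → ℂ) (ω₀' : Fin h → ℂ) (ω' : Fin h → Fin h → ℂ),
      (Matrix.of fun i j : ι => ∏ c ∈ w j, (ω₀ c + ∑ a ∈ u i, ω a c) +
        ∏ a ∈ u i, (ω₀' a + ∑ c ∈ w j, ω' c a)).det ≠ 0 := by
  classical
  obtain ⟨ω₀, ω, hω₀, hdet⟩ := exists_table_const_ne_zero u w hex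
  -- normalise the constants to `1`
  set lam : Fin h → ℂ := fun c => (ω₀ c)⁻¹ with hlam
  have hdet1 : (Matrix.of fun i j : ι =>
      ∏ c ∈ w j, ((1 : ℂ) + ∑ a ∈ u i, lam c * ω a c)).det ≠ 0 := by
    have h := det_additive_rescale u w ω₀ ω lam
    have hone : ∀ c, lam c * ω₀ c = 1 := fun c => by rw [hlam]; exact inv_mul_cancel₀ (hω₀ c)
    simp only [hone] at h
    rw [h]
    refine mul_ne_zero (Finset.prod_ne_zero_iff.mpr fun j _ =>
      Finset.prod_ne_zero_iff.mpr fun c _ => ?_) hdet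
    rw [hlam]; exact inv_ne_zero (hω₀ c)
  refine ⟨fun _ => 1, fun a c => lam c * ω a c, fun _ => 0, fun _ _ => 0, ?_⟩
  -- the zero table for `B` gives `B[i,j] = [u i = ∅]`; on the row `u i = ∅` the normalised `A` is `≡ 1`
  have hmat : (Matrix.of fun i j : ι => ∏ c ∈ w j, ((1 : ℂ) + ∑ a ∈ u i, lam c * ω a c) +
      ∏ a ∈ u i, ((0 : ℂ) + ∑ c ∈ w j, (0 : ℂ))) =
      Matrix.of fun i j : ι => (if u i = ∅ then (2 : ℂ) else 1) *
        ∏ c ∈ w j, ((1 : ℂ) + ∑ a ∈ u i, lam c * ω a c) := by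
    ext i j
    simp only [Matrix.of_apply, Finset.sum_const_zero, add_zero]
    by_cases hi : u i = ∅
    · rw [if_pos hi, hi]
      simp only [Finset.sum_empty, add_zero, Finset.prod_const_one, Finset.prod_empty]
      norm_num
    · obtain ⟨a, ha⟩ := Finset.nonempty_iff_ne_empty.mpr hi
      rw [if_neg hi, one_mul, Finset.prod_eq_zero ha rfl, add_zero]
  rw [hmat, Matrix.det_mul_column]
  refine mul_ne_zero (Finset.prod_ne_zero_iff.mpr fun i _ => ?_) hdet1
  split_ifs <;> norm_num

/-- **The SUM door dominates the mirror.** If some additive table is nonsingular on the mirrored layout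
`(w, u)`, some pair of tables makes the SUM matrix of `(u, w)` nonsingular. -/
theorem additiveSum_of_mirror {ι : Type*} [Fintype ι] [DecidableEq ι] (u w : ι → Finset (Fin h))
    (hex : ∃ (ω₀ : Fin h → ℂ) (ω : Fin h → Fin h → ℂ),
      (Matrix.of fun i j : ι => ∏ a ∈ u j, (ω₀ a + ∑ c ∈ w i, ω c a)).det ≠ 0) :
    ∃ (ω₀ : Fin h → ℂ) (ω : Fin h → Fin h → ℂ) (ω₀' : Fin h → ℂ) (ω' : Fin h → Fin h → ℂ),
      (Matrix.of fun i j : ι => ∏ c ∈ w j, (ω₀ c + ∑ a ∈ u i, ω a c) +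
        ∏ a ∈ u i, (ω₀' a + ∑ c ∈ w j, ω' c a)).det ≠ 0 := by
  classical
  obtain ⟨ω₀, ω, hω₀, hdet⟩ := exists_table_const_ne_zero w u hex
  set lam : Fin h → ℂ := fun a => (ω₀ a)⁻¹ with hlam
  have hdet1 : (Matrix.of fun i j : ι =>
      ∏ a ∈ u j, ((1 : ℂ) + ∑ c ∈ w i, lam a * ω c a)).det ≠ 0 := by
    have h := det_additive_rescale w u ω₀ ω lam
    have hone : ∀ a, lam a * ω₀ a = 1 := fun a => by rw [hlam]; exact inv_mul_cancel₀ (hω₀ a)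
    simp only [hone] at h
    rw [h]
    refine mul_ne_zero (Finset.prod_ne_zero_iff.mpr fun j _ =>
      Finset.prod_ne_zero_iff.mpr fun a _ => ?_) hdet
    rw [hlam]; exact inv_ne_zero (hω₀ a)
  -- transpose: the mirror matrix of `(u, w)` with this table is the transpose of the matrix above
  have hdet1' : (Matrix.of fun i j : ι =>
      ∏ a ∈ u i, ((1 : ℂ) + ∑ c ∈ w j, lam a * ω c a)).det ≠ 0 := by
    have : (Matrix.of fun i j : ι => ∏ a ∈ u i, ((1 : ℂ) + ∑ c ∈ w j, lam a * ω c a)) =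
        (Matrix.of fun i j : ι => ∏ a ∈ u j, ((1 : ℂ) + ∑ c ∈ w i, lam a * ω c a)).transpose := by
      ext i j; rfl
    rw [this, Matrix.det_transpose]; exact hdet1
  refine ⟨fun _ => 0, fun _ _ => 0, fun _ => 1, fun c a => lam a * ω c a, ?_⟩
  have hmat : (Matrix.of fun i j : ι => ∏ c ∈ w j, ((0 : ℂ) + ∑ a ∈ u i, (0 : ℂ)) +
      ∏ a ∈ u i, ((1 : ℂ) + ∑ c ∈ w j, lam a * ω c a)) =
      Matrix.of fun i j : ι => (if w j = ∅ then (2 : ℂ) else 1) *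
        ∏ a ∈ u i, ((1 : ℂ) + ∑ c ∈ w j, lam a * ω c a) := by
    ext i j
    simp only [Matrix.of_apply, Finset.sum_const_zero, add_zero]
    by_cases hj : w j = ∅
    · rw [if_pos hj, hj]
      simp only [Finset.sum_empty, add_zero, Finset.prod_const_one, Finset.prod_empty]
      norm_num
    · obtain ⟨c, hc⟩ := Finset.nonempty_iff_ne_empty.mpr hj
      rw [if_neg hj, one_mul, Finset.prod_eq_zero hc rfl, zero_add]
  rw [hmat, Matrix.det_mul_row]
  refine mul_ne_zero (Finset.prod_ne_zero_iff.mpr fun j _ => ?_) hdet1'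
  split_ifs <;> norm_num

/-- **Door v6 ⊇ door v5, pointwise.** On every layout where the additive table OR its mirror can be
made nonsingular, the SUM matrix can be made nonsingular. -/
theorem additiveSum_hyp_of_dichotomy_pointwise {ι : Type*} [Fintype ι] [DecidableEq ι]
    (u w : ι → Finset (Fin h))
    (hv5 : (∃ (ω₀ : Fin h → ℂ) (ω : Fin h → Fin h → ℂ),
        (Matrix.of fun i j : ι => ∏ c ∈ w j, (ω₀ c + ∑ a ∈ u i, ω a c)).det ≠ 0) ∨
      (∃ (ω₀ : Fin h → ℂ) (ω : Fin h → Fin h → ℂ),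
        (Matrix.of fun i j : ι => ∏ a ∈ u j, (ω₀ a + ∑ c ∈ w i, ω c a)).det ≠ 0)) :
    ∃ (ω₀ : Fin h → ℂ) (ω : Fin h → Fin h → ℂ) (ω₀' : Fin h → ℂ) (ω' : Fin h → Fin h → ℂ),
      (Matrix.of fun i j : ι => ∏ c ∈ w j, (ω₀ c + ∑ a ∈ u i, ω a c) +
        ∏ a ∈ u i, (ω₀' a + ∑ c ∈ w j, ω' c a)).det ≠ 0 := by
  rcases hv5 with hA | hB
  · exact additiveSum_of_additive u w hA
  · exact additiveSum_of_mirror u w hB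

end

end Summit.ValiantsHypothesis.ValiantsHypothesis.Theorems.BarrierLever.AdditiveDoor
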